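import Literature.NumberTheory.LFunctions.NoRealZeroSmallModuliII
import Literature.Barriers.RiemannHypothesis.EpsteinZetaRealZerosSmallK163
import HarnessLib

/-!
# No real zero for the ODD real primitive characters of conductor `≤ 163`, in the kernel
# (`NoRealZeroOddUpTo 163`, unconditionally)

Topic `Literature/NumberTheory/LFunctions`. One theorem (no definition, no named fact):
**`noRealZeroOddUpTo_onehundredsixtythree : NoRealZeroOddUpTo 163`** — for every modulus `3 ≤ q ≤ 163`,
every primitive quadratic ODD character `χ` mod `q` and every `σ ∈ (0, 1)`, `L(σ, χ) ≠ 0`. The odd half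
of the certified no-real-zero column (`NoRealZeroOddUpTo`, `NoRealZeroUpTo.lean`; printed frontier
Watkins 2004 to `3·10⁸`, certified by the `parity-realchar` cell to `10¹⁰`) thus has a KERNEL base of
`163` conductors proved outright: `q ≤ 4` by Fekete–Pólya positivity (inside `noRealZeroUpTo_fiftyTwo`),
`4 < q ≤ 163` by the Epstein class sum with `k ≤ 32/5`
(`Literature.Barriers.RiemannHypothesis.LFunction_ne_zero_of_odd_quadratic_of_le_onehundredsixtythree`:
`ζ(σ)L(σ, χ) = ½ Σ_Q Z_Q(σ) < 0` class by class). The even half has the kernel base `52`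
(`noRealZeroUpTo_fiftyTwo`); `d = 53` is the first even character where Fekete–Pólya of order `≤ 2` fails.

## References

* P. T. Bateman, E. Grosswald, *On Epstein's zeta function*, Acta Arith. 9 (1964) 365–373,
  Theorem 3. [BatemanGrosswald1964]
* M. Watkins, *Real zeros of real odd Dirichlet L-functions*, Math. Comp. 73 (2004) 415–423.
  [Watkins2004RealZeros]
* H. L. Montgomery, R. C. Vaughan, *Multiplicative Number Theory I*, CUP 2007, §11.2.
  [MontgomeryVaughan2007]
-/

namespace Literature.NumberTheory.LFunctions

open Literature.Barriers.RiemannHypothesis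

/-- **`NoRealZeroOddUpTo 163`, unconditionally**: no odd real primitive character of conductor `≤ 163`
has a real zero in `(0, 1)` (Fekete–Pólya for `q ≤ 4`, the Epstein class sum for `4 < q ≤ 163`).
[cite: BatemanGrosswald1964, Theorem 3] -/
theorem noRealZeroOddUpTo_onehundredsixtythree : NoRealZeroOddUpTo 163 := by
  intro q _ hq3 hq163 χ hquad hprim hodd σ hσ0 hσ1
  by_cases hq4 : q ≤ 4
  · exact noRealZeroUpTo_fiftyTwo q hq3 (by omega) χ hquad hprim σ hσ0 hσ1
  · exact LFunction_ne_zero_of_odd_quadratic_of_le_onehundredsixtythree (by omega) hq163 hprim hquad hodd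
      hσ0 hσ1

/-- Both kernel bases together: `NoRealZeroUpTo 52 ∧ NoRealZeroOddUpTo 163`. [cite: MontgomeryVaughan2007, §11.2] -/
theorem noRealZero_kernelBase : NoRealZeroUpTo 52 ∧ NoRealZeroOddUpTo 163 :=
  ⟨noRealZeroUpTo_fiftyTwo, noRealZeroOddUpTo_onehundredsixtythree⟩

end Literature.NumberTheory.LFunctions
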